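import Summits.HodgeConjecture.HodgeCM.Model.ArchLineSlotTypeCont_1

/-! PORT of `HodgeCM/Model/ArchLineSlotTypeCont.lean` (HodgeCMPerL run 82) — part 2: continuation of `Summits.HodgeConjecture.HodgeCM.Model.ArchLineSlotTypeCont_1` (split at a top-level declaration boundary by port_pkg.py; scope re-opened below; declarations unchanged). -/

-- port_pkg: scope re-opened for this part (file-level context, then the namespace/section stack open at the cut)
set_option autoImplicit false
noncomputable section
open scoped Matrix NumberField
open Literature.NumberTheory.Automorphic Literature.NumberTheory.Weil1964
open Literature.NumberTheory.GelbartRogawski1991.UnitaryDualPair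
open HodgeCM.Adelic HodgeCM.PerL34
namespace HodgeCM.Model.ArchSideTerm
section Assembly
variable
  (χV χW : ∀ {L : CMField} {ι₁ : L →+* ℂ} (_V : HermSpace3 L ι₁) (_c : SeesawCtx L),
    ContinuousMonoidHom (relNormOneIdeles (↥(NumberField.maximalRealSubfield (L : Type))) (L : Type) ⧸
      relNormOneRat (↥(NumberField.maximalRealSubfield (L : Type))) (L : Type)) Circle)
variable {L : CMField} {ι₁ : L →+* ℂ} (V : HermSpace3 L ι₁) (c : SeesawCtx L)
variable
  (hGR : (cmSplittingDatum (L : Type) finProdFinEquiv (frameD V) (frameD_real V) (frameD_ne V) (dW c.D) (dW_real c.D) (dW_ne c.D)).CompatibleSplitting)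
  (hGR₀ : (cmSplittingDatum (L : Type) (e₁) (frameD V) (frameD_real V) (frameD_ne V) (lineVec (L : Type) (dW c.D 0))
    (fun _ => dW_real c.D 0) (fun _ => dW_ne c.D 0)).CompatibleSplitting)
  (hGR₁ : (cmSplittingDatum (L : Type) (e₁) (frameD V) (frameD_real V) (frameD_ne V) (lineVec (L : Type) (dW c.D 1))
    (fun _ => dW_real c.D 1) (fun _ => dW_ne c.D 1)).CompatibleSplitting)
  (hGR₂ : (cmSplittingDatum (L : Type) (e₁) (frameD V) (frameD_real V) (frameD_ne V) (lineVec (L : Type) (dW' c.D 0))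
    (fun _ => dW'_real c.D 0) (fun _ => dW'_ne c.D 0)).CompatibleSplitting)
  (hGR₃ : (cmSplittingDatum (L : Type) (e₁) (frameD V) (frameD_real V) (frameD_ne V) (lineVec (L : Type) (dW' c.D 1))
    (fun _ => dW'_real c.D 1) (fun _ => dW'_ne c.D 1)).CompatibleSplitting)
  (μ : Fin 4 → NumberField.InfinitePlace (L : Type) → ℤ)
  (hpos₀ : 0 < HypCensus.cmXW (L : Type) (frameD V) (lineVec (L : Type) (dW c.D 0)) (fun _ => dW_real c.D 0) ι₁ (HypCensus.cmPlace (L : Type) ι₁) 0)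
  (hpos₁ : 0 < HypCensus.cmXW (L : Type) (frameD V) (lineVec (L : Type) (dW c.D 1)) (fun _ => dW_real c.D 1) ι₁ (HypCensus.cmPlace (L : Type) ι₁) 0)
  (hpos₂ : 0 < HypCensus.cmXW (L : Type) (frameD V) (lineVec (L : Type) (dW' c.D 0)) (fun _ => dW'_real c.D 0) ι₁ (HypCensus.cmPlace (L : Type) ι₁) 0)
  (hpos₃ : 0 < HypCensus.cmXW (L : Type) (frameD V) (lineVec (L : Type) (dW' c.D 1)) (fun _ => dW'_real c.D 1) ι₁ (HypCensus.cmPlace (L : Type) ι₁) 0)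
  (h₁W : (∀ j, 0 < (ι₁ (dW c.D j)).re) ∨ ∀ j, (ι₁ (dW c.D j)).re < 0)

/-- the four slot types of the S pin at the degree-one vectors of (F1) (eigen-characters `lineC`), as DATA (plane `dW` definite at `ι₁`). -/
def slotTypeVec : Fin 4 → NumberField.InfinitePlace (L : Type) → ℤ :=
  ![slotType (L := L) _ (continuous_slotChi₀_mul_lineCHom V c.D hGR hGR₀ hGR₁ h₁W),
    slotType (L := L) _ (continuous_slotChi₁_mul_lineCHom V c.D hGR hGR₀ hGR₁ h₁W),
    slotType (L := L) _ (continuous_slotChi₂_mul_lineCHom V c.D hGR hGR₂ hGR₃ h₁W),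
    slotType (L := L) _ (continuous_slotChi₃_mul_lineCHom V c.D hGR hGR₂ hGR₃ h₁W)]

/-- **(F1)'s ARCHIMEDEAN LINE DATUM WITH (J-μ) IN READ-OFF FORM**: at the Stage-B η `EtaChi.η @χV @χW` whose W-character has the slot-0 type
(`hW : archType (χW V c) = μ 0 − slotTypeVec 0`, e.g. `χW := EtaChi.χOfType @n` with `n V c = nWOf …`), the datum `archLineDatumOf` of theta-3's (F1)
needs NO `hμ₀` and takes `hμ₁₂₃` as the three INTEGER identities `slotTypeVec k − slotTypeVec 0 = μ k − μ 0`. -/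
def archLineDatumOfReadOff
    (hW : UnitaryLineChar.archType (L : Type) (χW V c) = μ 0 - slotTypeVec V c hGR hGR₀ hGR₁ hGR₂ hGR₃ h₁W 0)
    (hΔ₁ : slotTypeVec V c hGR hGR₀ hGR₁ hGR₂ hGR₃ h₁W 1 - slotTypeVec V c hGR hGR₀ hGR₁ hGR₂ hGR₃ h₁W 0 = μ 1 - μ 0)
    (hΔ₂ : slotTypeVec V c hGR hGR₀ hGR₁ hGR₂ hGR₃ h₁W 2 - slotTypeVec V c hGR hGR₀ hGR₁ hGR₂ hGR₃ h₁W 0 = μ 2 - μ 0)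
    (hΔ₃ : slotTypeVec V c hGR hGR₀ hGR₁ hGR₂ hGR₃ h₁W 3 - slotTypeVec V c hGR hGR₀ hGR₁ hGR₂ hGR₃ h₁W 0 = μ 3 - μ 0) :
    ArchLineDatum V c.D hGR hGR₀ hGR₁ hGR₂ hGR₃ (EtaChi.η @χV @χW V c) μ :=
  archLineDatumOf V c.D hGR hGR₀ hGR₁ hGR₂ hGR₃ (EtaChi.η @χV @χW V c) μ hpos₀ hpos₁ hpos₂ hpos₃
    (hμ₀_of_archType_eq χV χW V c hGR hGR₀ hGR₁ _ (continuous_slotChi₀_mul_lineCHom V c.D hGR hGR₀ hGR₁ h₁W) μ hW)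
    ((hμ₁_iff_sub χV χW V c hGR hGR₀ hGR₁ _ _ (continuous_slotChi₀_mul_lineCHom V c.D hGR hGR₀ hGR₁ h₁W)
      (continuous_slotChi₁_mul_lineCHom V c.D hGR hGR₀ hGR₁ h₁W) μ hW).2 hΔ₁)
    ((hμ₂_iff_sub χV χW V c hGR hGR₀ hGR₁ hGR₂ hGR₃ _ _ (continuous_slotChi₀_mul_lineCHom V c.D hGR hGR₀ hGR₁ h₁W)
      (continuous_slotChi₂_mul_lineCHom V c.D hGR hGR₂ hGR₃ h₁W) μ hW).2 hΔ₂)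
    ((hμ₃_iff_sub χV χW V c hGR hGR₀ hGR₁ hGR₂ hGR₃ _ _ (continuous_slotChi₀_mul_lineCHom V c.D hGR hGR₀ hGR₁ h₁W)
      (continuous_slotChi₃_mul_lineCHom V c.D hGR hGR₂ hGR₃ h₁W) μ hW).2 hΔ₃)

/-- the read-off datum IS (F1)'s datum (same `Φinf`, `x₀`, `c`): only the provenance of the `hμ` fields differs. -/
theorem archLineDatumOfReadOff_Φinf
    (hW : UnitaryLineChar.archType (L : Type) (χW V c) = μ 0 - slotTypeVec V c hGR hGR₀ hGR₁ hGR₂ hGR₃ h₁W 0)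
    (hΔ₁ : slotTypeVec V c hGR hGR₀ hGR₁ hGR₂ hGR₃ h₁W 1 - slotTypeVec V c hGR hGR₀ hGR₁ hGR₂ hGR₃ h₁W 0 = μ 1 - μ 0)
    (hΔ₂ : slotTypeVec V c hGR hGR₀ hGR₁ hGR₂ hGR₃ h₁W 2 - slotTypeVec V c hGR hGR₀ hGR₁ hGR₂ hGR₃ h₁W 0 = μ 2 - μ 0)
    (hΔ₃ : slotTypeVec V c hGR hGR₀ hGR₁ hGR₂ hGR₃ h₁W 3 - slotTypeVec V c hGR hGR₀ hGR₁ hGR₂ hGR₃ h₁W 0 = μ 3 - μ 0) :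
    (archLineDatumOfReadOff χV χW V c hGR hGR₀ hGR₁ hGR₂ hGR₃ μ hpos₀ hpos₁ hpos₂ hpos₃ h₁W hW hΔ₁ hΔ₂ hΔ₃).Φinf =
      linePhiVec V c.D hpos₀ hpos₁ hpos₂ hpos₃ :=
  rfl

end Assembly

end HodgeCM.Model.ArchSideTerm

end
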